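import Summits.FinalStateConjecture.FinalStateConjecture.Theses.DerivativeThrift
import Summits.FinalStateConjecture.FinalStateConjecture.Theses.PhaseMixingCapture
import Summits.FinalStateConjecture.FinalStateConjecture.Theses.TangentConeAtIPlus
import Summits.FinalStateConjecture.FinalStateConjecture.Theorems.DerivativeThriftThriftyHandoffDefs
import Summits.FinalStateConjecture.FinalStateConjecture.Theorems.DerivativeThriftThriftyHandoffSelfWitness
import Literature.Geometry.Lorentzian.TameGenericityDiagonal
import HarnessLib

/-!
# Line skeleton v3 for crux `ThriftyHandoff` (stmt-FinalStateConjecture-17612),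
# route `DerivativeThrift` — "capture pointwise at order 2, the generic legs along censorship curves"

Lead c1 (prover-line-stmt-FinalStateConjecture-17612-c1-0), 2026-08-17. Target: the route decl
`Summit.FinalStateConjecture.FinalStateConjecture.Theses.DerivativeThrift.ThriftyHandoff` BY NAME,
concluded by `ThriftyHandoff_of` from five named stubs; `sorry` occurs only inside the four OPEN `stub_*`
(stub 2a `stub_upgradableSelfWitness` is closed by its landed proof).

## The line and its reshapes

The crux is ONE tame-Christodoulou-generic property `ThriftyProp` of admissible data (MGHD exists;
every MGHD has complete `𝓘⁺`, captures rays for every honest typed decomposition, and admits a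
thrifty hand-over). Tame genericity is not closed under `∧`, so the line enters through the curve
kernel `InitialDataSet.isTameChristodoulouGeneric_of_relative'`: a generic HYPOTHESIS (tame weak
cosmic censorship) yields a generic CONCLUSION by producing the conclusion ALONG censorship curves,
and `IsTameChristodoulouGeneric.mono` upgrades pointwise. Vocabulary (`WeakHandoff`, `FullHandoff`,
`RaysCaptured`, `Censored`, `UpgradableCensored`, `ThriftyProp`): the Theses-free definitions file
`Theorems/DerivativeThriftThriftyHandoffDefs.lean` (verbatim clause bodies, named once).

* v1 (birth, planner-skel-…-17612-0): four stubs with def-free verbatim signatures.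
* v2 (lead c1, reshape 1): stubs 1 and 4 stated BY THE NAME of the existing items they coincide
  with verbatim — `stub_tameCensorship : …PhaseMixingCapture.WeakCosmicCensorshipTame` (item
  stmt-FinalStateConjecture-17269) and `stub_raysCaptured :
  …TangentConeAtIPlus.SettledExteriorHoldsRays` (item stmt-FinalStateConjecture-17673, shared with
  RaychaudhuriBlowdown) — their own chains work them; this line holds the legs nobody else holds.
* v3 (lead c1, reshape 2, after wave 1 returned `stub-misstated` on the transversality stub): the
  birth cut copied the `hrel` binder of the kernel, which (D1) omits `¬ P (F 0)` although the kernel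
  only ever calls `hrel` at `P`-exceptional base data — so the stub owed, in its constant branch,
  "good curves through GOOD data" on top of the genuine transversality content — and (D2) pinned the
  handed-back curve to the SAME end `e`, while tame genericity asks for SOME end and every
  witness-curve tool of the tree lands on a collared end. Repair, keeping the composition: the
  `hrel` leg is split by `by_cases UpgradableCensored (F 0)` into
  `stub_upgradableSelfWitness` (2a: through every upgradably-censored admissible datum passes a tame
  injective immersed admissible curve of such data, on some end — PROVABLE NOW by breathing
  self-witnesses and `precomp` transport, landed separately) and the corrected residue
  `stub_recessionAlongCensoredCurves` (2b: the registered text plus the hypothesis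
  `¬ UpgradableCensored (F 0)` and with the end re-chosen, `∃ e'`) — both WEAKER than the v1/v2 stub,
  and the glue still closes the crux (kernel `_of_relative'`). `stub_censoredCapture` is restated
  over `WeakHandoff` (same proposition, `Iff.rfl`).

Stubs (v3): `stub_tameCensorship` (= item 17269) · `stub_upgradableSelfWitness` (2a, closes now) ·
`stub_recessionAlongCensoredCurves` (2b, the generic third law + generic hyperbolic recession along
censored tame curves at EXCEPTIONAL base data; open, XL) · `stub_censoredCapture` (pointwise weak
thrifty hand-over of censored MGHDs at order 2; the hardest, the lead's; open, XXL) ·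
`stub_raysCaptured` (= item 17673). Disproof used: no `Cruxes/ThriftyHandoff/Disproof.lean` exists;
`ledger negatives`: 1 refuted statement (uniform photon-sphere channels), unrelated. Slack audit:
clause (iii)'s lab time `τ` is absorbed by `Φ` (time-translation covariance of layer, background and
norm), so "∃ τ ≥ τ₁" is idle — cosmetic; no emptiness/junk route to any stub (Lines/birth.md, wave-1
findings `work/stubs/stub_recessionAlongCensoredCurves.md` in the lead's folder).
-/

noncomputable section

-- D-0017: single-problem summit, `Summit.<S>.<S>.…` by design (cf. lakefile `weak.linter.dupNamespace`).
set_option linter.dupNamespace false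

open Set Function Filter
open scoped Manifold ContDiff Topology ENNReal

namespace Summit.FinalStateConjecture.FinalStateConjecture.Cruxes.ThriftyHandoff.Birth

open Literature.Geometry.Lorentzian
open Summit.FinalStateConjecture.FinalStateConjecture.Theorems.DerivativeThriftThriftyHandoff
  (WeakHandoff FullHandoff RaysCaptured Censored UpgradableCensored ThriftyProp
    thriftyProp_of_upgradableCensored)

/-! ## §1 The stubs (`sorry` only here) -/

/-- **Stub 1 — tame weak cosmic censorship**, BY NAME the shared item
stmt-FinalStateConjecture-17269 (`PhaseMixingCapture.WeakCosmicCensorshipTame`): tame-generically in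
the admissible class an MGHD exists and every MGHD has complete `𝓘⁺`. Christodoulou, CQG 16 (1999)
A23, p. A24; Dafermos–Rodnianski arXiv:0811.0354 §2.6.2. Open problem (weak cosmic censorship);
necessary for the crux (`weakCosmicCensorshipTame_of_thriftyHandoff`, landed). Worked by its own
crux chain (Cruxes/WeakCosmicCensorshipTame). -/
theorem stub_tameCensorship :
    Summit.FinalStateConjecture.FinalStateConjecture.Theses.PhaseMixingCapture.WeakCosmicCensorshipTame := by
  sorry

/-- **Stub 2a — upgradable self-witnesses (the `P`-good half of the kernel's `hrel`; closes now).**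
Through every admissible datum `d` with `UpgradableCensored d` passes a tame (on SOME end: a collar
of the datum's own sole end), injective, immersed-at-`0` curve of admissible data all of whose
members are upgradably censored — the breathing curve of `d`, along which the property is INVARIANT
(members are re-indexings `Φ_t^* d`; their MGHDs are those of `d` precomposed, and the hand-over
clauses read only the spacetime and `range ι`). CLOSED: proof landed
(`Theorems/DerivativeThriftThriftyHandoffSelfWitness.lean`, p147207) and quoted here by name. [folklore] -/
theorem stub_upgradableSelfWitness : open Literature.Geometry.Lorentzian Summit.FinalStateConjecture.FinalStateConjecture.Theorems.DerivativeThriftThriftyHandoff in open scoped Manifold in ∀ (X : Type) [TopologicalSpace X] [ChartedSpace E3 X] [IsManifold (𝓡 3) ((⊤ : ℕ∞) : WithTop ℕ∞) X] [T2Space X] [SecondCountableTopology X] [ConnectedSpace X], ∀ d ∈ admissibleVacuumData X, UpgradableCensored d → ∃ (e' : AFEnd X) (F' : EuclideanSpace ℝ (Fin 1) → InitialDataSet (𝓡 3) X), InitialDataSet.IsTameDataFamily e' 1 F' ∧ F' 0 = d ∧ Function.Injective F' ∧ InitialDataSet.IsImmersedAtZero 1 F' ∧ (∀ c, F' c ∈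 admissibleVacuumData X) ∧ ∀ c ≠ 0, UpgradableCensored (F' c) :=
  -- LANDED (p147207, Theorems/DerivativeThriftThriftyHandoffSelfWitness.lean): the registered stub by name
  Summit.FinalStateConjecture.FinalStateConjecture.Theorems.DerivativeThriftThriftyHandoff.stub_upgradableSelfWitness

/-- **Stub 2b — the generic legs along censored tame curves at EXCEPTIONAL base data (the honest
transversality content: generic third law + generic hyperbolic recession).** For every end `e` and
every tame curve `F` of admissible data on `e` — immersed-at-`0` and injective, or constant — whose
base datum is NOT upgradably censored and whose members off `0` are censored, there is a tame curve
`F'` of admissible data on SOME end `e'` through the same base datum, injective and immersed at `0`,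
whose members off `0` are upgradably censored (censored, and every weak thrifty hand-over of every
MGHD upgrades to one with sub-extremal labels and pairwise distinct terminal velocities).
Informally: the data whose censored developments settle with an extremal member (Kehle–Unger
arXiv:2211.15742: extremal horizons DO form, in codimension expected ≥ 1) or with two equal
terminal velocities (parabolic / Chazy-type final motions) form a set that a tame admissible curve
through any exceptional datum can be chosen to meet only at its base point while staying censored.
Why it might fail: the extremal threshold or the parabolic stratum need not be a tame hypersurface
(one-sided or Cantor accumulation along curves, arXiv:2402.10190 §1.4.5); staying censored while
leaving the stratum is itself a transversality claim between two exceptional sets; genuine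
(non-gauge) tame admissible deformations through an arbitrary datum exist in the tree only as the
unproved fact `ChruscielDelay_localConstraintDeformation`. Sources: Christodoulou1999 (p. A24),
arXiv:2211.15742, arXiv:2402.10190, arXiv:1710.01722 (§1.2.1). Open problem (XL). -/
theorem stub_recessionAlongCensoredCurves : open Literature.Geometry.Lorentzian Summit.FinalStateConjecture.FinalStateConjecture.Theorems.DerivativeThriftThriftyHandoff in open scoped Manifold in ∀ (X : Type) [TopologicalSpace X] [ChartedSpace E3 X] [IsManifold (𝓡 3) ((⊤ : ℕ∞) : WithTop ℕ∞) X] [T2Space X] [SecondCountableTopology X] [ConnectedSpace X], ∀ (e : AFEnd X) (F : EuclideanSpace ℝ (Fin 1) → InitialDataSet (𝓡 3) X), InitialDataSet.IsTameDataFamily e 1 F → ((InitialDataSet.IsImmersedAtZero 1 F ∧ Function.Injective F) ∨ ∀ c, F c = F 0) → (∀ c, F c ∈ admissibleVacuumData X) → ¬ UpgradableCensored (F 0) → (∀ c ≠ 0, Censored (F c)) → ∃ (e' : AFEnd X) (F' : EuclideanSpace ℝ (Fin 1) → InitialDataSet (𝓡 3) X), InitialDataSet.IsTameDataFamily e' 1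 F' ∧ F' 0 = F 0 ∧ Function.Injective F' ∧ InitialDataSet.IsImmersedAtZero 1 F' ∧ (∀ c, F' c ∈ admissibleVacuumData X) ∧ ∀ c ≠ 0, UpgradableCensored (F' c) := by
  sorry

/-- **Stub 3 — censored thrift capture, pointwise (the route's layer-2 node `CensoredThriftCapture`;
the physical heart of the crux; the lead's stub).** For every admissible datum, every MGHD with
complete future null infinity admits a WEAK thrifty hand-over (`WeakHandoff`: `N ≥ 0`, closed labels
`|aᵢ| ≤ Mᵢ`, orthochronous motions, and for every `ℓ > 0`, `ε > 0`, `τ₁` a lab time `τ ≥ τ₁`,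
separated non-approaching centres and a smooth open embedding of the `N`-hole hyperboloidal layer
into `J⁺(ιX)` with achronal leaves and `𝔑_(2,1/2,1/2) ≤ ε`). Contains, pointwise on censored
developments: finiteness of the number of black holes, absence of eternal non-Kerr vacuum end
states, eventual separation of the holes, and late-time closeness at ORDER 2 ONLY (near `C²` sup +
far `r^p`/transversal fluxes of `ψ_m = r D^m h`, `m ≤ 2`, `p = δ = 1/2`). Why it might fail: a
censored development with a non-Kerr `ω`-limit, a perpetually bound cluster, infinitely many ever
smaller holes, or no regularity gain from energy-level budgets to order 2. Sources: arXiv:1710.01722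
(Conj. 1, §1.2.1), KlainermanSzeftel2023 (§3.6), DafermosRodnianski2013, Bieri2010JDG,
arXiv:2211.15742. Open problem (XXL); nothing in the tree produces a `RecedingKerr.layer` chart of
finite layer norm in any development. -/
theorem stub_censoredCapture : open Literature.Geometry.Lorentzian Summit.FinalStateConjecture.FinalStateConjecture.Theorems.DerivativeThriftThriftyHandoff in open scoped Manifold in ∀ (X : Type) [TopologicalSpace X] [ChartedSpace E3 X] [IsManifold (𝓡 3) ((⊤ : ℕ∞) : WithTop ℕ∞) X] [T2Space X] [SecondCountableTopology X] [ConnectedSpace X], ∀ D ∈ admissibleVacuumData X, ∀ 𝒟 : VacuumCauchyDevelopment D, 𝒟.IsMaximal → Summit.FinalStateConjecture.HasCompleteNullInfinity 𝒟.toCauchyDevelopment → WeakHandoff 𝒟 := by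
  sorry

/-- **Stub 4 — rays are captured by every honest decomposition, pointwise**, BY NAME the shared item
stmt-FinalStateConjecture-17673 (`TangentConeAtIPlus.SettledExteriorHoldsRays` =
`RaychaudhuriBlowdown.SettledExteriorHoldsRays`): for every admissible datum, every censored MGHD
and every honest typed `(O, d)`, `RaysStayInClosure 𝒟 O`. Dafermos–Luk arXiv:1710.01722 (interior
termination); topology risk (`ℝ³ # T³` pockets) recorded on that item; worked by its own chain
(Cruxes/SettledExteriorHoldsRays). Open (L–XL). -/
theorem stub_raysCaptured :
    Summit.FinalStateConjecture.FinalStateConjecture.Theses.TangentConeAtIPlus.SettledExteriorHoldsRays := by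
  sorry

/-! ## §2 The composition: the crux BY NAME from the five stubs (no `sorry` outside the stubs) -/

/-- **The crux body from the five stub statements (sorry-free glue).** `ThriftyHandoff` at `X` is
tame genericity of `ThriftyProp` (definitionally). Step 1: tame genericity of `UpgradableCensored`
by the kernel `isTameChristodoulouGeneric_of_relative'` with `Q := Censored` (stub 1), sole strongly
flat ends from `exists_isSoleEnd_of_mem_admissibleVacuumData`, and `hrel` assembled by
`by_cases UpgradableCensored (F 0)` from stub 2a (good base) and stub 2b (exceptional base).
Step 2: `.mono` with the pointwise upgrade `thriftyProp_of_upgradableCensored` fed by stub 3 (weak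
hand-over of each censored MGHD) and stub 4 (ray capture at each censored MGHD). [folklore] -/
theorem thriftyHandoff_of_stubSigs
    (h₁ : Summit.FinalStateConjecture.FinalStateConjecture.Theses.PhaseMixingCapture.WeakCosmicCensorshipTame)
    (h₂a : open Literature.Geometry.Lorentzian Summit.FinalStateConjecture.FinalStateConjecture.Theorems.DerivativeThriftThriftyHandoff in open scoped Manifold in ∀ (X : Type) [TopologicalSpace X] [ChartedSpace E3 X] [IsManifold (𝓡 3) ((⊤ : ℕ∞) : WithTop ℕ∞) X] [T2Space X] [SecondCountableTopology X] [ConnectedSpace X], ∀ d ∈ admissibleVacuumData X, UpgradableCensored d → ∃ (e' : AFEnd X) (F' : EuclideanSpace ℝ (Fin 1) → InitialDataSet (𝓡 3) X), InitialDataSet.IsTameDataFamily e' 1 F' ∧ F' 0 = d ∧ Function.Injective F' ∧ InitialDataSet.IsImmersedAtZero 1 F' ∧ (∀ c, F' c ∈ admissibleVacuumData X) ∧ ∀ c ≠ 0, UpgradableCensored (F' c))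
    (h₂b : open Literature.Geometry.Lorentzian Summit.FinalStateConjecture.FinalStateConjecture.Theorems.DerivativeThriftThriftyHandoff in open scoped Manifold in ∀ (X : Type) [TopologicalSpace X] [ChartedSpace E3 X] [IsManifold (𝓡 3) ((⊤ : ℕ∞) : WithTop ℕ∞) X] [T2Space X] [SecondCountableTopology X] [ConnectedSpace X], ∀ (e : AFEnd X) (F : EuclideanSpace ℝ (Fin 1) → InitialDataSet (𝓡 3) X), InitialDataSet.IsTameDataFamily e 1 F → ((InitialDataSet.IsImmersedAtZero 1 F ∧ Function.Injective F) ∨ ∀ c, F c = F 0) → (∀ c, F c ∈ admissibleVacuumData X) → ¬ UpgradableCensored (F 0) → (∀ c ≠ 0, Censored (F c)) → ∃ (e' : AFEnd X) (F' : EuclideanSpace ℝ (Fin 1) → InitialDataSet (𝓡 3) X), InitialDataSet.IsTameDataFamily e' 1 F' ∧ F' 0 = F 0 ∧ Function.Injective F' ∧ InitialDataSet.IsImmersedAtZero 1 F' ∧ (∀ c, F' c ∈ admissibleVacuumData X) ∧ ∀ c ≠ 0, UpgradableCensored (F' c))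
    (h₃ : open Literature.Geometry.Lorentzian Summit.FinalStateConjecture.FinalStateConjecture.Theorems.DerivativeThriftThriftyHandoff in open scoped Manifold in ∀ (X : Type) [TopologicalSpace X] [ChartedSpace E3 X] [IsManifold (𝓡 3) ((⊤ : ℕ∞) : WithTop ℕ∞) X] [T2Space X] [SecondCountableTopology X] [ConnectedSpace X], ∀ D ∈ admissibleVacuumData X, ∀ 𝒟 : VacuumCauchyDevelopment D, 𝒟.IsMaximal → Summit.FinalStateConjecture.HasCompleteNullInfinity 𝒟.toCauchyDevelopment → WeakHandoff 𝒟)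
    (h₄ : Summit.FinalStateConjecture.FinalStateConjecture.Theses.TangentConeAtIPlus.SettledExteriorHoldsRays) :
    Summit.FinalStateConjecture.FinalStateConjecture.Theses.DerivativeThrift.ThriftyHandoff := by
  intro X _ _ _ _ _ _
  -- Step 1: tame genericity of the UPGRADABLE censored property, produced along censorship curves
  have key : InitialDataSet.IsTameChristodoulouGeneric (admissibleVacuumData X)
      (UpgradableCensored (X := X)) 1 := by
    refine InitialDataSet.isTameChristodoulouGeneric_of_relative' (Q := Censored (X := X))
      (fun d hd ↦ exists_isSoleEnd_of_mem_admissibleVacuumData hd) (h₁ X) ?_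
    intro e F hF hdich hadm hQ
    by_cases hP : UpgradableCensored (F 0)
    · exact h₂a X (F 0) (hadm 0) hP
    · exact h₂b X e F hF hdich hadm hP hQ
  -- Step 2: pointwise upgrade on admissible data
  refine key.mono ?_
  intro D hD hP
  exact thriftyProp_of_upgradableCensored hP (h₃ X D hD) (h₄ X D hD)

/-- **`ThriftyHandoff` (the route decl, by name) from the five declared stubs (by name).** -/
theorem ThriftyHandoff_of :
    Summit.FinalStateConjecture.FinalStateConjecture.Theses.DerivativeThrift.ThriftyHandoff :=
  thriftyHandoff_of_stubSigs stub_tameCensorship stub_upgradableSelfWitness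
    stub_recessionAlongCensoredCurves stub_censoredCapture stub_raysCaptured

end Summit.FinalStateConjecture.FinalStateConjecture.Cruxes.ThriftyHandoff.Birth

end
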